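import Literature.Computability.Cryptography.RejectionSamplerMachine
import Literature.Computability.Complexity.CodeFPBudgets
import HarnessLib

/-!
# The h₃ machine's modulus-switch kernel on ONE sample as a typed polynomial-time program

Topic `Computability/Cryptography` (LWE), grouping namespace `BLPRS2013.KProg`; program side of the sampling recipe of
`LWESwitchSamplingForm.lean` (`samplingPMF`, the point kernel `switchPoint` of Cor. 3.2 in sampling form: `kⱼ ← D_{ℤ,qr,q·aⱼ/Q}`,
`a' = k mod q`, `b̄' = ⟨a', t⟩ + ⌊q b̄/Q + q u/Q + q w⌉`) as a finite-precision machine realises it — `kⱼ` by GPV's rejection sampler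
(`RejectionSamplerMachine.lean`), the jitter `u` by the midpoint of a dyadic cell `k_P` read off `P` coins, `q w` by `κ̂·G/2ᵇ` with
`G` from the pseudo-Gaussian sampler, i.e. `b̄' = ⟨a', t⟩ + ⌊c' + q((k_P+½)/2ᴾ - ½)/Q + κ̂·G/2ᵇ⌉ mod q`; the LAW of this machine recipe
and its distance to `samplingPMF` are the business of forthcoming sequels (`LWESwitchMachineKernel.lean`,
`LWESwitchKernelProgLaw.lean`). Here that recipe is written as a DETERMINISTIC function of the shift `t`, the input sample
`(a, b̄)` (residues as naturals) and a flat coin string, first in closed form (`kernelFlat`, with the tree's flat samplers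
`GaussRejMachine.rejFlat` and `PGParams.samplerFlat`) and then as a program against a parameter record (`kernelOf`), proved
equal to the closed form at the genuine record (`kernelOf_kRecOf`) and TYPED POLYNOMIAL TIME in `(record, t, sample, coins)`
(**`kernelOf_codeFP`**) — assembled from `GaussRejMachine.rejOf_codeFP`, `samplerOf_codeFP`, `unMul_codeFP`, `strChunks`,
`zipWith`, `map`, `intSum` and exact rational arithmetic (`ratRound`). The layout of the coins: `n` chunks of width `C = R(w+1+P_r)`
for the integers, then `P` bits for the jitter cell, then `coinLen` bits for the pseudo-Gaussian. Everything PROVED,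
definitions with bodies; no named fact; no machine is written (the law on uniform coins is the business of the sequel).

## References

* Z. Brakerski, A. Langlois, C. Peikert, O. Regev, D. Stehlé, *Classical hardness of learning with errors*, STOC 2013;
  arXiv:1306.0281, Lemma 3.5 / Cor. 3.2 (the map) and §5 (efficient sampling). [BrakerskiEtAl2013]
* S. Arora, B. Barak, *Computational Complexity: A Modern Approach*, CUP 2009, §1.3 (closure of polynomial time under
  composition and polynomially bounded loops), Def. 7.1 (coins as a uniform string). [AroraBarak2009]
-/

noncomputable section

namespace Literature.Computability.Cryptography

namespace BLPRS2013

namespace KProg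

open Literature.Computability.Complexity Literature.Computability.Complexity.CodeFP
  Literature.Computability.QuantumComplexity Literature.Probability.Distributions GaussRejMachine GaussRejFP
open Literature.Algebra.EuclideanLattices (encodeRat encodeRat_injective)

/-! ### The closed form -/

/-- **The centre `q·a/Q` of an input residue `a`**, as a rational. [cite: BrakerskiEtAl2013, Lemma 3.5 (the map)] -/
def cRat (q Q a : ℕ) : ℚ := (((q * a : ℕ) : ℤ) : ℚ) / (Q : ℚ)

/-- **The rational that is rounded**: `c' + q((k_P+½)/2ᴾ - ½)/Q + κ̂·G/2ᵇ = q b̄/Q + q(2k_P+1-2ᴾ)/(2^{P+1}Q) + κ̂·G/2ᵇ`.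
[cite: BrakerskiEtAl2013, Cor. 3.2 (the rounding `⌊q·⌉`) with §5] -/
def zRat (q Q : ℕ) (κh : ℚ) (b P bbar kP : ℕ) (G : ℤ) : ℚ :=
  cRat q Q bbar + (((q : ℤ) * (2 * (kP : ℤ) + 1 - 2 ^ P)) : ℚ) / (((2 ^ (P + 1) * Q : ℕ) : ℤ) : ℚ) +
    κh * (((G : ℤ) : ℚ) / (((2 ^ b : ℕ) : ℤ) : ℚ))

/-- **One switched sample as a function of `(t, (a, b̄), coins)`**: the integers `kⱼ` by the flat rejection sampler on
the `j`-th chunk of width `C = R(w+1+P_r)`, the cell `k_P` from the next `P` bits, `G` by the flat pseudo-Gaussian sampler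
on the next `coinLen` bits, then `a' = k mod q`, `b̄' = (⟨a', t⟩ + ⌊zRat⌉) mod q`. [cite: BrakerskiEtAl2013, Lemma 3.5 (the map) with §5] -/
def kernelFlat (θ : ℚ) (s N Pr w R q Q : ℕ) (κh : ℚ) (b P : ℕ) (PG : PGParams) (t a : List ℕ) (bbar : ℕ)
    (coins : List Bool) : List ℕ × ℕ :=
  let C := R * (w + 1 + Pr)
  let ks := List.zipWith (fun aj ch => rejFlat θ (cRat q Q aj) s N Pr w R ch) a
    ((List.range a.length).map fun j => (coins.drop (j * C)).take C)
  let rest := coins.drop (a.length * C)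
  let kP := bitsToNat (rest.take P)
  let G := PG.samplerFlat ((rest.drop P).take PG.coinLen)
  let z := round (zRat q Q κh b P bbar kP G)
  let a' := ks.map fun k => (k % (q : ℤ)).toNat
  (a', (((List.zipWith (fun x y : ℕ => ((x * y : ℕ) : ℤ)) a' t).sum + z) % (q : ℤ)).toNat)

/-! ### The record and the program -/

/-- The rejection sampler's parameters without the centre: `(θ, (s, N, P_r, 2ˢ))` (three unary, the padding unary). [folklore] -/
abbrev KBase : Type := ℚ × (ℕ × ℕ × ℕ × ℕ)

/-- Its code. [folklore] -/
abbrev kBaseE : KBase → List Bool := pairE encodeRat (pairE unE (pairE unE (pairE unE unE)))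

/-- **The kernel's parameter record**: `((base, (w, R)), ((q, Q), ((κ̂, b, P), (pg, coinLen))))`. [folklore] -/
abbrev KRec : Type := (KBase × (ℕ × ℕ)) × ((ℕ × ℕ) × ((ℚ × ℕ × ℕ) × (SamplerCtx × ℕ)))

/-- Its code (loop bounds and widths unary, moduli binary, rationals as rationals). [folklore] -/
abbrev kRecE : KRec → List Bool :=
  pairE (pairE kBaseE (pairE unE unE))
    (pairE (pairE natE natE) (pairE (pairE encodeRat (pairE unE unE)) (pairE samplerCtxE unE)))

/-- The rejection sampler's record for the centre `c`. [folklore] -/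
def rejCtx' (r : KRec) (c : ℚ) : RejCtx := ((r.1.1.1, (c, r.1.1.2)), r.1.2)

/-- The chunk width `C = R(w+1+P_r)`. [folklore] -/
def width (r : KRec) : ℕ := r.1.2.2 * (r.1.2.1 + 1 + r.1.1.2.2.2.1)

/-- **The genuine record** of the parameters `θ s N P_r w R q Q κ̂ b P` and the pseudo-Gaussian `PG`. [folklore] -/
def kRecOf (θ : ℚ) (s N Pr w R q Q : ℕ) (κh : ℚ) (b P : ℕ) (PG : PGParams) : KRec :=
  (((θ, (s, N, Pr, 2 ^ s)), (w, R)), ((q, Q), ((κh, b, P), (PG.ctx, PG.coinLen))))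

/-- The input `(t, ((a, b̄), coins))`. [folklore] -/
abbrev KIn : Type := List ℕ × ((List ℕ × ℕ) × List Bool)

/-- Its code. [folklore] -/
abbrev kInE : KIn → List Bool := pairE (rawE natE) (pairE (pairE (rawE natE) natE) strE)

/-- **The kernel against the record.** [cite: BrakerskiEtAl2013, Lemma 3.5 (the map) with §5] -/
def kernelOf (r : KRec) (x : KIn) : List ℕ × ℕ :=
  let q := r.2.1.1
  let Q := r.2.1.2
  let C := width r
  let a := x.2.1.1
  let coins := x.2.2
  let ks := List.zipWith (fun aj ch => rejOf (rejCtx' r (cRat q Q aj)) ch) a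
    ((List.range a.length).map fun j => (coins.drop (j * C)).take C)
  let rest := coins.drop (min (a.length * C) coins.length)
  let kP := bitsToNat (rest.take r.2.2.1.2.2)
  let G := samplerOf r.2.2.2.1 ((rest.drop r.2.2.1.2.2).take r.2.2.2.2)
  let z := round (zRat q Q r.2.2.1.1 r.2.2.1.2.1 r.2.2.1.2.2 x.2.1.2 kP G)
  let a' := ks.map fun k => (k % (q : ℤ)).toNat
  (a', (((List.zipWith (fun x y : ℕ => ((x * y : ℕ) : ℤ)) a' x.1).sum + z) % (q : ℤ)).toNat)

/-- Dropping at least the whole list is dropping the whole list (a local twin of `Lem75Q.drop_min_length` in the Barriers tree,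
which is not importable here). [folklore] -/
theorem drop_min_length (l : List Bool) (k : ℕ) : l.drop (min k l.length) = l.drop k := by
  rcases le_total k l.length with h | h
  · rw [min_eq_left h]
  · rw [min_eq_right h, List.drop_of_length_le le_rfl, List.drop_of_length_le h]

/-- **At the genuine record the program is the closed form.** [folklore] -/
theorem kernelOf_kRecOf (θ : ℚ) (s N Pr w R q Q : ℕ) (κh : ℚ) (b P : ℕ) (PG : PGParams) (t a : List ℕ) (bbar : ℕ)
    (coins : List Bool) :
    kernelOf (kRecOf θ s N Pr w R q Q κh b P PG) (t, ((a, bbar), coins)) = kernelFlat θ s N Pr w R q Q κh b P PG t a bbar coins := by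
  have hW : width (kRecOf θ s N Pr w R q Q κh b P PG) = R * (w + 1 + Pr) := rfl
  have hRC : ∀ c : ℚ, rejCtx' (kRecOf θ s N Pr w R q Q κh b P PG) c = rejCtxOf θ c s N Pr w R := fun c => rfl
  unfold kernelOf kernelFlat
  simp only [hW, hRC, rejOf_rejCtxOf, drop_min_length]
  simp only [kRecOf, samplerOf_ctx]

/-! ### Typed polynomial time -/

section CodeFP

/-- The argument code `(record, input)`. [folklore] -/
abbrev kArgE : KRec × KIn → List Bool := pairE kRecE kInE

/-- `(q, Q, a) ↦ q·a/Q ∈ ℚ` is typed polynomial time. [folklore] -/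
theorem cRat_codeFP : CodeFP (pairE (pairE natE natE) natE) encodeRat (fun p => cRat p.1.1 p.1.2 p.2) := by
  have hq : CodeFP (pairE (pairE natE natE) natE) natE (fun p => p.1.1) := (fst _ _).fst'
  have hQ : CodeFP (pairE (pairE natE natE) natE) natE (fun p => p.1.2) := (fst _ _).snd'
  have ha : CodeFP (pairE (pairE natE natE) natE) natE (fun p => p.2) := snd _ _
  exact ((ratOfIntNat.comp ((intOfNat.comp (natMul.comp (hq.pair ha))).pair hQ)).congr fun p => by simp [cRat])

/-- The argument code of `zRat`: `(((q, Q), (κ̂, b, P)), (b̄, (k_P, G)))`. [folklore] -/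
abbrev zArgE : ((ℕ × ℕ) × (ℚ × ℕ × ℕ)) × (ℕ × (ℕ × ℤ)) → List Bool :=
  pairE (pairE (pairE natE natE) (pairE encodeRat (pairE unE unE))) (pairE natE (pairE natE intE))

/-- `zRat` is typed polynomial time in `((q, Q), (κ̂, b, P)), (b̄, k_P, G)`. [folklore] -/
theorem zRat_codeFP :
    CodeFP zArgE encodeRat (fun p => zRat p.1.1.1 p.1.1.2 p.1.2.1 p.1.2.2.1 p.1.2.2.2 p.2.1 p.2.2.1 p.2.2.2) := by
  -- names for the projections
  have hq : CodeFP zArgE natE (fun p => p.1.1.1) := (fst _ _).fst'.fst'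
  have hQ : CodeFP zArgE natE (fun p => p.1.1.2) := (fst _ _).fst'.snd'
  have hκ : CodeFP zArgE encodeRat (fun p => p.1.2.1) := (fst _ _).snd'.fst'
  have hb : CodeFP zArgE unE (fun p => p.1.2.2.1) := (fst _ _).snd'.snd'.fst'
  have hP : CodeFP zArgE unE (fun p => p.1.2.2.2) := (fst _ _).snd'.snd'.snd'
  have hbbar : CodeFP zArgE natE (fun p => p.2.1) := (snd _ _).fst'
  have hkP : CodeFP zArgE natE (fun p => p.2.2.1) := (snd _ _).snd'.fst'
  have hG : CodeFP zArgE intE (fun p => p.2.2.2) := (snd _ _).snd'.snd'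
  -- `c' = q b̄/Q`
  have hc : CodeFP zArgE encodeRat (fun p => cRat p.1.1.1 p.1.1.2 p.2.1) :=
    (cRat_codeFP.comp ((hq.pair hQ).pair hbbar) :)
  -- the jitter term `q(2k_P + 1 - 2ᴾ)/(2^{P+1} Q)`
  have h2P : CodeFP zArgE natE (fun p => 2 ^ p.1.2.2.2) :=
    (natPow.comp ((const _ 2).pair hP) :)
  have h2P1 : CodeFP zArgE natE (fun p => 2 ^ (p.1.2.2.2 + 1)) :=
    (natPow.comp ((const _ 2).pair (unSucc.comp hP)) :)
  have hnum : CodeFP zArgE intE (fun p =>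
      (p.1.1.1 : ℤ) * (2 * (p.2.2.1 : ℤ) + 1 - 2 ^ p.1.2.2.2)) := by
    have h1 : CodeFP zArgE intE (fun p => 2 * (p.2.2.1 : ℤ) + 1) :=
      ((intAdd.comp ((intMul.comp ((const _ (2 : ℤ)).pair (intOfNat.comp hkP))).pair (const _ (1 : ℤ)))) :)
    have h2 : CodeFP zArgE intE (fun p => 2 * (p.2.2.1 : ℤ) + 1 - 2 ^ p.1.2.2.2) :=
      ((intSub.comp (h1.pair (intOfNat.comp h2P))).congr fun p => by push_cast; ring)
    exact ((intMul.comp ((intOfNat.comp hq).pair h2)) :)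
  have hden : CodeFP zArgE natE (fun p => 2 ^ (p.1.2.2.2 + 1) * p.1.1.2) :=
    (natMul.comp (h2P1.pair hQ) :)
  have hjit : CodeFP zArgE encodeRat (fun p =>
      (((p.1.1.1 : ℤ) * (2 * (p.2.2.1 : ℤ) + 1 - 2 ^ p.1.2.2.2)) : ℚ) / (((2 ^ (p.1.2.2.2 + 1) * p.1.1.2 : ℕ) : ℤ) : ℚ)) :=
    ((ratOfIntNat.comp (hnum.pair hden)).congr fun p => by push_cast; ring)
  -- the Gaussian term `κ̂ G/2ᵇ`
  have h2b : CodeFP zArgE natE (fun p => 2 ^ p.1.2.2.1) :=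
    (natPow.comp ((const _ 2).pair hb) :)
  have hgau : CodeFP zArgE encodeRat (fun p =>
      p.1.2.1 * (((p.2.2.2 : ℤ) : ℚ) / (((2 ^ p.1.2.2.1 : ℕ) : ℤ) : ℚ))) :=
    ((ratMul.comp (hκ.pair (ratOfIntNat.comp (hG.pair h2b)))).congr fun p => by push_cast; ring)
  exact ((ratAdd.comp ((ratAdd.comp (hc.pair hjit)).pair hgau)).congr fun p => by rfl)

/-- The kernel's pieces read off the argument: abbreviations of the projections. [folklore] -/
theorem rec_codeFP : CodeFP kArgE kRecE (fun p => p.1) := fst _ _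

/-- **The rejection sampler with the record's parameters and a computed centre**, on a chunk:
`((r, (a_j, chunk)) ↦ rejOf (rejCtx' r (q a_j/Q)) chunk` is typed polynomial time. [cite: AroraBarak2009, §1.3] -/
theorem rejStep_codeFP : CodeFP (pairE kRecE (pairE natE strE)) intE (fun p => rejOf (rejCtx' p.1 (cRat p.1.2.1.1 p.1.2.1.2 p.2.1)) p.2.2) := by
  have hr : CodeFP (pairE kRecE (pairE natE strE)) kRecE (fun p => p.1) := fst _ _
  have hθ : CodeFP (pairE kRecE (pairE natE strE)) encodeRat (fun p => p.1.1.1.1) := hr.fst'.fst'.fst'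
  have htail : CodeFP (pairE kRecE (pairE natE strE)) (pairE unE (pairE unE (pairE unE unE))) (fun p => p.1.1.1.2) := hr.fst'.fst'.snd'
  have hwR : CodeFP (pairE kRecE (pairE natE strE)) (pairE unE unE) (fun p => p.1.1.2) := hr.fst'.snd'
  have hqQ : CodeFP (pairE kRecE (pairE natE strE)) (pairE natE natE) (fun p => p.1.2.1) := hr.snd'.fst'
  have ha : CodeFP (pairE kRecE (pairE natE strE)) natE (fun p => p.2.1) := (snd _ _).fst'
  have hch : CodeFP (pairE kRecE (pairE natE strE)) strE (fun p => p.2.2) := (snd _ _).snd'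
  have hc : CodeFP (pairE kRecE (pairE natE strE)) encodeRat (fun p => cRat p.1.2.1.1 p.1.2.1.2 p.2.1) :=
    (cRat_codeFP.comp (hqQ.pair ha) :)
  have hctx : CodeFP (pairE kRecE (pairE natE strE)) rejCtxE (fun p => rejCtx' p.1 (cRat p.1.2.1.1 p.1.2.1.2 p.2.1)) :=
    ((hθ.pair (hc.pair htail)).pair hwR).congr fun p => rfl
  exact (rejOf_codeFP.comp (hctx.pair hch) :)

/-- **The kernel is typed polynomial time** in `(record, (t, ((a, b̄), coins)))`. [cite: BrakerskiEtAl2013, §5; AroraBarak2009, §1.3] -/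
theorem kernelOf_codeFP : CodeFP kArgE (pairE (rawE natE) natE) (fun p => kernelOf p.1 p.2) := by
  -- projections
  have hr : CodeFP kArgE kRecE (fun p => p.1) := fst _ _
  have ht : CodeFP kArgE (rawE natE) (fun p => p.2.1) := (snd _ _).fst'
  have ha : CodeFP kArgE (rawE natE) (fun p => p.2.2.1.1) := (snd _ _).snd'.fst'.fst'
  have hbbar : CodeFP kArgE natE (fun p => p.2.2.1.2) := (snd _ _).snd'.fst'.snd'
  have hcoins : CodeFP kArgE strE (fun p => p.2.2.2) := (snd _ _).snd'.snd'
  have hw : CodeFP kArgE unE (fun p => p.1.1.2.1) := hr.fst'.snd'.fst'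
  have hR : CodeFP kArgE unE (fun p => p.1.1.2.2) := hr.fst'.snd'.snd'
  have hPr : CodeFP kArgE unE (fun p => p.1.1.1.2.2.2.1) := hr.fst'.fst'.snd'.snd'.snd'.fst'
  have hqQ : CodeFP kArgE (pairE natE natE) (fun p => p.1.2.1) := hr.snd'.fst'
  have hq : CodeFP kArgE natE (fun p => p.1.2.1.1) := hqQ.fst'
  have hκbP : CodeFP kArgE (pairE encodeRat (pairE unE unE)) (fun p => p.1.2.2.1) := hr.snd'.snd'.fst'
  have hP : CodeFP kArgE unE (fun p => p.1.2.2.1.2.2) := hκbP.snd'.snd'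
  have hpg : CodeFP kArgE samplerCtxE (fun p => p.1.2.2.2.1) := hr.snd'.snd'.snd'.fst'
  have hpgLen : CodeFP kArgE unE (fun p => p.1.2.2.2.2) := hr.snd'.snd'.snd'.snd'
  -- the width `C` (unary) and the `n` chunks
  have hC : CodeFP kArgE unE (fun p => width p.1) :=
    (unMul_codeFP.comp (hR.pair (unAdd.comp ((unSucc.comp hw).pair hPr)))).congr fun p => by simp [width]
  have hn : CodeFP kArgE unE (fun p => p.2.2.1.1.length) := ((ulength natE).comp ha :)
  have hchunks : CodeFP kArgE (rawE strE)
      (fun p => (List.range p.2.2.1.1.length).map fun j => (p.2.2.2.drop (j * width p.1)).take (width p.1)) :=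
    (strChunks.comp (hn.pair (hC.pair hcoins)) :)
  -- the integers `kⱼ`
  have hks : CodeFP kArgE (rawE intE) (fun p => List.zipWith (fun aj ch => rejOf (rejCtx' p.1 (cRat p.1.2.1.1 p.1.2.1.2 aj)) ch)
      p.2.2.1.1 ((List.range p.2.2.1.1.length).map fun j => (p.2.2.2.drop (j * width p.1)).take (width p.1))) :=
    ((zipWith rejStep_codeFP).comp (hr.pair (ha.pair hchunks)) :)
  -- the rest of the coins
  have hoff : CodeFP kArgE unE (fun p => min (p.2.2.1.1.length * width p.1) p.2.2.2.length) :=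
    (unOfNatMin.comp ((strLength.comp hcoins).pair (natMul.comp ((natOfUn.comp hn).pair (natOfUn.comp hC)))) :)
  have hrest : CodeFP kArgE strE (fun p => p.2.2.2.drop (min (p.2.2.1.1.length * width p.1) p.2.2.2.length)) :=
    (strDrop.comp (hoff.pair hcoins) :)
  -- the cell `k_P` and the pseudo-Gaussian `G`
  have hkP : CodeFP kArgE natE (fun p => bitsToNat ((p.2.2.2.drop (min (p.2.2.1.1.length * width p.1) p.2.2.2.length)).take p.1.2.2.1.2.2)) :=
    (strVal.comp (strTake.comp (hP.pair hrest)) :)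
  have hG : CodeFP kArgE intE (fun p => samplerOf p.1.2.2.2.1
      (((p.2.2.2.drop (min (p.2.2.1.1.length * width p.1) p.2.2.2.length)).drop p.1.2.2.1.2.2).take p.1.2.2.2.2)) :=
    (samplerOf_codeFP.comp (hpg.pair (strTake.comp (hpgLen.pair (strDrop.comp (hP.pair hrest))))) :)
  -- the rounded value `z`
  have hz : CodeFP kArgE intE (fun p => round (zRat p.1.2.1.1 p.1.2.1.2 p.1.2.2.1.1 p.1.2.2.1.2.1 p.1.2.2.1.2.2 p.2.2.1.2
      (bitsToNat ((p.2.2.2.drop (min (p.2.2.1.1.length * width p.1) p.2.2.2.length)).take p.1.2.2.1.2.2))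
      (samplerOf p.1.2.2.2.1 (((p.2.2.2.drop (min (p.2.2.1.1.length * width p.1) p.2.2.2.length)).drop p.1.2.2.1.2.2).take p.1.2.2.2.2)))) :=
    (ratRound.comp (zRat_codeFP.comp ((hqQ.pair hκbP).pair (hbbar.pair (hkP.pair hG)))) :)
  -- `a' = k mod q` (as naturals), with the record as context
  have hmodStep : CodeFP (pairE kRecE intE) natE (fun p => (p.2 % (p.1.2.1.1 : ℤ)).toNat) := by
    have hk : CodeFP (pairE kRecE intE) intE (fun p => p.2) := snd _ _
    have hq' : CodeFP (pairE kRecE intE) intE (fun p => (p.1.2.1.1 : ℤ)) := (intOfNat.comp (fst _ _).snd'.fst'.fst' :)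
    have hmod : CodeFP (pairE kRecE intE) intE (fun p => p.2 % (p.1.2.1.1 : ℤ)) :=
      ((intSub.comp (hk.pair (intMul.comp (hq'.pair (intEDiv.comp (hk.pair hq')))))).congr fun p => by
        rw [Int.emod_def])
    exact (intToNat.comp hmod :)
  have ha' : CodeFP kArgE (rawE natE) (fun p => (List.zipWith (fun aj ch => rejOf (rejCtx' p.1 (cRat p.1.2.1.1 p.1.2.1.2 aj)) ch)
      p.2.2.1.1 ((List.range p.2.2.1.1.length).map fun j => (p.2.2.2.drop (j * width p.1)).take (width p.1))).map
        fun k => (k % (p.1.2.1.1 : ℤ)).toNat) :=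
    ((map hmodStep).comp (hr.pair hks) :)
  -- `⟨a', t⟩` over `ℤ`
  have hprodStep : CodeFP (pairE kRecE (pairE natE natE)) intE (fun p => ((p.2.1 * p.2.2 : ℕ) : ℤ)) :=
    (intOfNat.comp (natMul.comp ((snd _ _).fst'.pair (snd _ _).snd')) :)
  have hdot : CodeFP kArgE intE (fun p => (List.zipWith (fun x y : ℕ => ((x * y : ℕ) : ℤ))
      ((List.zipWith (fun aj ch => rejOf (rejCtx' p.1 (cRat p.1.2.1.1 p.1.2.1.2 aj)) ch)
        p.2.2.1.1 ((List.range p.2.2.1.1.length).map fun j => (p.2.2.2.drop (j * width p.1)).take (width p.1))).map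
          fun k => (k % (p.1.2.1.1 : ℤ)).toNat) p.2.1).sum) :=
    (intSum.comp ((zipWith hprodStep).comp (hr.pair (ha'.pair ht))) :)
  -- `b̄' = (⟨a', t⟩ + z) mod q`
  have hq' : CodeFP kArgE intE (fun p => (p.1.2.1.1 : ℤ)) := (intOfNat.comp hq :)
  have hsum : CodeFP kArgE intE (fun p => (List.zipWith (fun x y : ℕ => ((x * y : ℕ) : ℤ))
      ((List.zipWith (fun aj ch => rejOf (rejCtx' p.1 (cRat p.1.2.1.1 p.1.2.1.2 aj)) ch)
        p.2.2.1.1 ((List.range p.2.2.1.1.length).map fun j => (p.2.2.2.drop (j * width p.1)).take (width p.1))).map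
          fun k => (k % (p.1.2.1.1 : ℤ)).toNat) p.2.1).sum +
      round (zRat p.1.2.1.1 p.1.2.1.2 p.1.2.2.1.1 p.1.2.2.1.2.1 p.1.2.2.1.2.2 p.2.2.1.2
        (bitsToNat ((p.2.2.2.drop (min (p.2.2.1.1.length * width p.1) p.2.2.2.length)).take p.1.2.2.1.2.2))
        (samplerOf p.1.2.2.2.1 (((p.2.2.2.drop (min (p.2.2.1.1.length * width p.1) p.2.2.2.length)).drop p.1.2.2.1.2.2).take p.1.2.2.2.2)))) :=
    (intAdd.comp (hdot.pair hz) :)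
  have hb' : CodeFP kArgE natE (fun p => (((List.zipWith (fun x y : ℕ => ((x * y : ℕ) : ℤ))
      ((List.zipWith (fun aj ch => rejOf (rejCtx' p.1 (cRat p.1.2.1.1 p.1.2.1.2 aj)) ch)
        p.2.2.1.1 ((List.range p.2.2.1.1.length).map fun j => (p.2.2.2.drop (j * width p.1)).take (width p.1))).map
          fun k => (k % (p.1.2.1.1 : ℤ)).toNat) p.2.1).sum +
      round (zRat p.1.2.1.1 p.1.2.1.2 p.1.2.2.1.1 p.1.2.2.1.2.1 p.1.2.2.1.2.2 p.2.2.1.2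
        (bitsToNat ((p.2.2.2.drop (min (p.2.2.1.1.length * width p.1) p.2.2.2.length)).take p.1.2.2.1.2.2))
        (samplerOf p.1.2.2.2.1 (((p.2.2.2.drop (min (p.2.2.1.1.length * width p.1) p.2.2.2.length)).drop p.1.2.2.1.2.2).take p.1.2.2.2.2))))
        % (p.1.2.1.1 : ℤ)).toNat) := by
    have hmod : CodeFP kArgE intE (fun p => _ % (p.1.2.1.1 : ℤ)) :=
      ((intSub.comp (hsum.pair (intMul.comp (hq'.pair (intEDiv.comp (hsum.pair hq')))))).congr fun p => by
        rw [Int.emod_def])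
    exact (intToNat.comp hmod :)
  exact (ha'.pair hb').congr fun p => rfl

end CodeFP

end KProg

end BLPRS2013

end Literature.Computability.Cryptography

end
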